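import Summits.QuantumFields.YangMills.Theorems.FluctuationComparisonRegPrIntLS2BetaNeumannFRD
import Literature.Probability.LatticeModels.LocalPerturbationGaussian
import Literature.Probability.Distributions.GaussianLinearCompensation

/-!
# The Neumann sub-fields: remainder covariance, Gaussian convolution, finite-range dependence (NFRD-C)

Helper file for crux `Summit.QuantumFields.YangMills.Theses.UnitScaleTilt.FluctuationComparisonRegPrIntL`
(item stmt-QuantumFields-20520), `--supports`, hypothesis form, **definition-free**.  Third file on
crux idea `neumann-frd-step` (card `Cruxes/FluctuationComparisonRegPrIntL/Ideas/neumann-frd-step.md`),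
after NFRD-A `…S2BetaNeumannFRDPieces` (pieces: range, locality, decay, `Matrix.PosSemidef`) and
NFRD-B `…S2BetaNeumannFRD` (series, the sketch's `NeumannFRD` / `NeumannFRDFamilyLocal` by text).  It
supplies what "the one-step fluctuation Gaussian becomes a sum of independent FINITE-RANGE Gaussian
sub-fields, each a local perturbation of a finite-range dependent reference process" needs AT THE
LEVEL OF LAWS, for `M` real symmetric with `m‖z‖² ≤ zᵀMz ≤ B‖z‖²` (`0 < m ≤ B`), `X := 1 - B⁻¹•M`:

* §1 THE TAIL (`hasSum_neumann_tail`): `HasSum (k ↦ B⁻¹ • X^(k+n)) (X^n * M⁻¹)` — the remainder of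
  the exact finite decomposition `M⁻¹ = ∑_{t<n} B⁻¹•X^t + X^n * M⁻¹` (✓`inv_eq_sum_add_pow_mul_inv`)
  is the tail of the Neumann series;
* §2 THE REMAINDER IS A COVARIANCE (`isSymm_pow_mul_inv`, `posSemidef_pow_mul_inv`): `X^n * M⁻¹` is
  symmetric and `Matrix.PosSemidef` (limits of symmetric positive partial sums, entrywise);
* §3 THE FLUCTUATION LAW IS A CONVOLUTION (`multivariateGaussian_inv_eq_conv`): by the tree's
  ✓`Literature.Probability.Distributions.multivariateGaussian_conv` (`N(0,S₁) ∗ N(0,S₂) = N(0,S₁+S₂)`),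
  `N(0, M⁻¹) = N(0, ∑_{t<n} B⁻¹•X^t) ∗ N(0, X^n M⁻¹)` — the two-piece form; iterate the tree lemma
  along `Finset.range n` (✓`posSemidef_neumannPiece`) for more pieces;
* §4 DOCKING TO THE TREE'S ENGINE (`isLocalPerturbation_neumannSubfield`): the `t`-th sub-field law
  `N(0, B⁻¹•X^t)` with cells = blocks `verts p` and adjacency `R` ⊇ "blocks at `dist` ≤ r t" is a
  finite-range dependent reference process: block-local bounded factors form an
  ✓`IsLocalPerturbation` (tree ✓`IsLocalPerturbation.multivariateGaussian` fed by NFRD-A's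
  `posSemidef_neumannPiece` and `neumannPiece_apply_eq_zero_of_lt_dist`), whence
  ✓`pertZ_eq_polymerPartitionFunction`, ✓`isKPVolume_connActivity` / the weighted E′
  (`…S2BetaEPrimeWeightedKP`), ✓`exp_pertLogZ` apply to that sub-field.

Sources: [cite: BrydgesGuadagniMitter2004, arXiv:math-ph/0303013, §1–2 (finite-range
decomposition, finite-range property)]; [cite: Bauerschmidt2013, arXiv:1206.2212, §1];
[cite: BauerschmidtBrydgesSlade2019, §3.3].

HONEST LABEL.  Linear algebra and Gaussian bookkeeping supplying NO estimate of the lane: not GAS₁,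
not REP; it proves no stub; the crux idea's sharp-window bookkeeping across sub-fields is untouched;
nothing of `FluctuationComparisonRegPrIntL` (20520) is proved here.  Rung R3 (YM₃ = SU(2) on T³) is
NOT d = 4, NOT infinite volume, NOT a mass gap, NOT the Clay problem.
-/

noncomputable section

namespace Summit.QuantumFields.YangMills.Theorems.FluctuationComparisonRegPrIntLS2BetaNeumannSubfields

open Matrix Finset Filter Topology MeasureTheory ProbabilityTheory
open Literature.Probability.LatticeModels
open Summit.QuantumFields.YangMills.Theorems.FluctuationComparisonRegPrIntLS2BetaNeumannFRDPieces
open Summit.QuantumFields.YangMills.Theorems.FluctuationComparisonRegPrIntLS2BetaNeumannFRD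

variable {ι : Type*} [Fintype ι] [DecidableEq ι]

/-! ## §1 The tail of the Neumann series is the remainder -/

/-- `HasSum (k ↦ B⁻¹ • X^(k+n)) (X^n * M⁻¹)` for `X := 1 - B⁻¹ • M`, under the hypotheses of
✓`hasSum_neumann`. -/
theorem hasSum_neumann_tail (M : Matrix ι ι ℝ) (hM : M.IsSymm) {m B : ℝ} (hm : 0 < m) (hmB : m ≤ B)
    (hlo : ∀ z : ι → ℝ, m * (z ⬝ᵥ z) ≤ z ⬝ᵥ M *ᵥ z)
    (hhi : ∀ z : ι → ℝ, z ⬝ᵥ M *ᵥ z ≤ B * (z ⬝ᵥ z)) (n : ℕ) :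
    HasSum (fun k : ℕ => B⁻¹ • (1 - B⁻¹ • M) ^ (k + n)) ((1 - B⁻¹ • M) ^ n * M⁻¹) := by
  have h := hasSum_neumann M hM hm hmB hlo hhi
  have hdec := inv_eq_sum_add_pow_mul_inv M (isUnit_det_of_coercive M hm hlo) B n
  have hrem : (1 - B⁻¹ • M) ^ n * M⁻¹ =
      M⁻¹ - ∑ i ∈ Finset.range n, B⁻¹ • (1 - B⁻¹ • M) ^ i := by
    rw [eq_sub_iff_add_eq, add_comm]
    exact hdec.symm
  rw [hrem]
  exact (hasSum_nat_add_iff' n).2 h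

/-! ## §2 The remainder is a covariance -/

/-- The remainder `X^n * M⁻¹` is symmetric (a limit of symmetric partial sums). -/
theorem isSymm_pow_mul_inv (M : Matrix ι ι ℝ) (hM : M.IsSymm) {m B : ℝ} (hm : 0 < m) (hmB : m ≤ B)
    (hlo : ∀ z : ι → ℝ, m * (z ⬝ᵥ z) ≤ z ⬝ᵥ M *ᵥ z)
    (hhi : ∀ z : ι → ℝ, z ⬝ᵥ M *ᵥ z ≤ B * (z ⬝ᵥ z)) (n : ℕ) :
    ((1 - B⁻¹ • M) ^ n * M⁻¹).IsSymm := by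
  have h := hasSum_neumann_tail M hM hm hmB hlo hhi n
  have ht := h.matrix_transpose
  have heq : (fun k : ℕ => (B⁻¹ • (1 - B⁻¹ • M) ^ (k + n))ᵀ) =
      fun k : ℕ => B⁻¹ • (1 - B⁻¹ • M) ^ (k + n) := by
    funext k
    rw [transpose_smul, (isSymm_neumannPiece hM B (k + n)).eq]
  rw [heq] at ht
  exact ht.unique h

/-- The remainder `X^n * M⁻¹` is positive semi-definite in Mathlib's sense — the covariance of the
last (infinite-range) sub-field. -/
theorem posSemidef_pow_mul_inv (M : Matrix ι ι ℝ) (hM : M.IsSymm) {m B : ℝ} (hm : 0 < m)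
    (hmB : m ≤ B) (hlo : ∀ z : ι → ℝ, m * (z ⬝ᵥ z) ≤ z ⬝ᵥ M *ᵥ z)
    (hhi : ∀ z : ι → ℝ, z ⬝ᵥ M *ᵥ z ≤ B * (z ⬝ᵥ z)) (n : ℕ) :
    ((1 - B⁻¹ • M) ^ n * M⁻¹).PosSemidef := by
  have hB : 0 < B := lt_of_lt_of_le hm hmB
  have h := hasSum_neumann_tail M hM hm hmB hlo hhi n
  have hpos := (neumannPiece_bounds M hM hm hmB hlo hhi).1
  refine Matrix.PosSemidef.of_dotProduct_mulVec_nonneg ?_ fun x => ?_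
  · rw [Matrix.IsHermitian, Matrix.conjTranspose_eq_transpose_of_trivial]
    exact (isSymm_pow_mul_inv M hM hm hmB hlo hhi n).eq
  · rw [star_trivial, ← sum_sum_mul_eq_dotProduct_mulVec]
    -- the quadratic form is the sum of the (non-negative) forms of the tail pieces
    have hform : HasSum (fun k : ℕ => ∑ a, ∑ c, x a * (B⁻¹ • (1 - B⁻¹ • M) ^ (k + n)) a c * x c)
        (∑ a, ∑ c, x a * ((1 - B⁻¹ • M) ^ n * M⁻¹) a c * x c) := by
      refine hasSum_sum fun a _ => hasSum_sum fun c _ => ?_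
      have hac : HasSum (fun k : ℕ => (B⁻¹ • (1 - B⁻¹ • M) ^ (k + n)) a c)
          (((1 - B⁻¹ • M) ^ n * M⁻¹) a c) := Pi.hasSum.1 (Pi.hasSum.1 h a) c
      exact (hac.mul_left (x a)).mul_right (x c)
    refine hform.nonneg fun k => ?_
    rw [sum_sum_mul_eq_dotProduct_mulVec, Matrix.smul_mulVec, dotProduct_smul, smul_eq_mul]
    exact mul_nonneg (inv_pos.mpr hB).le (hpos (k + n) x).1

/-! ## §3 The fluctuation law is a convolution of the sub-field laws -/

/-- THE TWO-PIECE DECOMPOSITION OF THE FLUCTUATION LAW: `N(0, M⁻¹)` is the convolution of the laws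
of the first `n` Neumann sub-fields' sum `N(0, ∑_{t<n} B⁻¹•X^t)` and of the remainder field
`N(0, X^n M⁻¹)` (index type in `Type`, as the tree's convolution lemma).  (Iterating
✓`Literature.Probability.Distributions.multivariateGaussian_conv` along `Finset.range n` with
✓`posSemidef_neumannPiece` splits the first factor further.)
[cite: BrydgesGuadagniMitter2004, §1] -/
theorem multivariateGaussian_inv_eq_conv {κ : Type} [Fintype κ] [DecidableEq κ] (M : Matrix κ κ ℝ)
    (hM : M.IsSymm) {m B : ℝ} (hm : 0 < m) (hmB : m ≤ B)
    (hlo : ∀ z : κ → ℝ, m * (z ⬝ᵥ z) ≤ z ⬝ᵥ M *ᵥ z)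
    (hhi : ∀ z : κ → ℝ, z ⬝ᵥ M *ᵥ z ≤ B * (z ⬝ᵥ z)) (n : ℕ) :
    multivariateGaussian 0 M⁻¹ =
      multivariateGaussian (0 : EuclideanSpace ℝ κ) (∑ i ∈ Finset.range n, B⁻¹ • (1 - B⁻¹ • M) ^ i) ∗
        multivariateGaussian 0 ((1 - B⁻¹ • M) ^ n * M⁻¹) := by
  have hsumPSD : ∀ k : ℕ, (∑ i ∈ Finset.range k, B⁻¹ • (1 - B⁻¹ • M) ^ i).PosSemidef := by
    intro k
    induction k with
    | zero => simpa using Matrix.PosSemidef.zero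
    | succ k ih =>
      rw [Finset.sum_range_succ]
      exact ih.add (posSemidef_neumannPiece M hM hm hmB hlo hhi k)
  rw [Literature.Probability.Distributions.multivariateGaussian_conv (hsumPSD n)
    (posSemidef_pow_mul_inv M hM hm hmB hlo hhi n),
    ← inv_eq_sum_add_pow_mul_inv M (isUnit_det_of_coercive M hm hlo) B n]

/-! ## §4 Docking: each sub-field is a finite-range dependent reference process -/

/-- **THE `t`-TH NEUMANN SUB-FIELD IS A LOCAL-PERTURBATION REFERENCE.**  For `M` real symmetric of
range `r` (w.r.t. `dist`) with `m‖z‖² ≤ zᵀMz ≤ B‖z‖²` (`0 < m ≤ B`): under the sub-field law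
`N(0, B⁻¹•(1 - B⁻¹•M)^t)`, with cells `p : V` carrying blocks `verts p` and an adjacency `R` holding
between distinct cells having sites at `dist ≤ r t`, block-local factors bounded by `ε ≥ 0` form an
`IsLocalPerturbation` — so the tree's engine (✓`pertZ_eq_polymerPartitionFunction`,
✓`isKPVolume_connActivity`, the weighted E′, ✓`exp_pertLogZ`) applies to that sub-field.
[cite: BauerschmidtBrydgesSlade2019, §3.3] [cite: BrydgesGuadagniMitter2004, §1] -/
theorem isLocalPerturbation_neumannSubfield {V : Type*} (dist : ι → ι → ℕ) (hd0 : ∀ a, dist a a = 0)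
    (htri : ∀ a b c, dist a c ≤ dist a b + dist b c) (M : Matrix ι ι ℝ) (hM : M.IsSymm) (r : ℕ)
    (hrange : ∀ a c, r < dist a c → M a c = 0) {m B : ℝ} (hm : 0 < m) (hmB : m ≤ B)
    (hlo : ∀ z : ι → ℝ, m * (z ⬝ᵥ z) ≤ z ⬝ᵥ M *ᵥ z)
    (hhi : ∀ z : ι → ℝ, z ⬝ᵥ M *ᵥ z ≤ B * (z ⬝ᵥ z)) (t : ℕ) (verts : V → Finset ι)
    {R : V → V → Prop} (hR : ∀ p q, p ≠ q → ∀ a ∈ verts p, ∀ b ∈ verts q, dist a b ≤ r * t → R p q)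
    {g : V → EuclideanSpace ℝ ι → ℂ} {ε : ℝ} (hε : 0 ≤ ε)
    (hg : ∀ p, Measurable[⨆ a ∈ verts p,
      MeasurableSpace.comap (fun z : EuclideanSpace ℝ ι => z a) inferInstance] (g p))
    (hgε : ∀ p z, ‖g p z‖ ≤ ε) :
    IsLocalPerturbation (multivariateGaussian 0 (B⁻¹ • (1 - B⁻¹ • M) ^ t)) R
      (fun p => ⨆ a ∈ verts p,
        MeasurableSpace.comap (fun z : EuclideanSpace ℝ ι => z a) inferInstance) g ε := by
  refine IsLocalPerturbation.multivariateGaussian (posSemidef_neumannPiece M hM hm hmB hlo hhi t)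
    dist (r * t) (fun a b hab => ?_) verts hR hε hg hgε
  rw [Matrix.smul_apply, neumannPiece_apply_eq_zero_of_lt_dist dist hd0 htri M r B hrange t a b hab,
    smul_zero]

end Summit.QuantumFields.YangMills.Theorems.FluctuationComparisonRegPrIntLS2BetaNeumannSubfields

end
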